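import Summits.QuantumFields.YangMills.Theorems.StaticSourceWitnessRungGaussianPair

/-!
# Route `StaticSourceWitness`, crux X₁ `StaticSourceResponse` (stmt-QuantumFields-25284):
# lattice-Maxwell rung, file 3/5 — the static-source response identity ON THE LATTICE

Banking file (`--supports stmt-QuantumFields-25284`), port of Part B of the crux workfile
`Cruxes/StaticSourceResponse/Lines/rung.lean` v3 (seat `ym-mirror-bc5w-1`, 2026-08-28).

The abelian lattice gauge theory at Gaussian (fixed) coupling, `μM = curvatureGaussianField 4 1`:
plaquette curvatures `Y_q = ω q 0` with the Garban–Sepúlveda covariance `dGd*` (tree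
`curvatureTwoPoint`).  The mirror Wilson loop of a plaquette set is `w = cos Φ_rect`,
`Φ_rect = ∑_{p ∈ rect} Y_p` (lattice Stokes), the probe is `Ṽ_v = probe a v L = ∑_y v(a y) ∑_{q at y} Y_q²`.

* `hasGaussianLaw_holonomy_plaquette` — `(Φ_rect, Y_q)` is a centred Gaussian pair under `μM`
  (`IsGaussianProcess.of_isGaussianProcess` on the finite-sum process);
* `cov_holonomy_plaquette` — lattice linear response `Cov(Φ_rect, Y_q) = dipoleField rect q`;
* `latticeMaxwell_plaquette_response` — (★) on the lattice: `Cov_μ(w, Y_q²) = −E_μ[w]·dipoleField(q)²`;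
* `latticeMaxwell_wLoop_eq/_pos` — `E_μ[w] = e^{−Var Φ_rect/2} > 0` (perimeter-small but positive);
* `latticeMaxwell_probe_response` — `Cov_μ(w, Ṽ_v) = −E_μ[w] · dipoleEnergy a v rect L` for every
  spacing `a`, probe `v`, rectangle and volume cut-off `L`;
* `latticeMaxwell_X1_of_floor` — X₁'s witness clause verbatim, `0 < E[w] ∧ c₁·E[w] ≤ |Cov(w, Ṽ_v)|`,
  from the purely DETERMINISTIC floor `c₁ ≤ dipoleEnergy` with the SAME `c₁` (no loss from the
  perimeter-small `E[w]`).  Files 4–5 prove that floor in a hyperscaling configuration.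

Separation from S (same free abelian universality class): `BalabanLadder.NT` clause (ii) fails in
free Maxwell₄ (tree `SelfNormalisedSkewness.Negative.maxwellRing3_eq_zero`: the connected three-point
functional of `F²` vanishes identically), while X₁'s analogue here holds.
NOTHING here proves the Yang–Mills mass gap, `BalabanLadder.NT`, or X₁.
-/

set_option autoImplicit false

open MeasureTheory ProbabilityTheory
open scoped Real NNReal ENNReal

noncomputable section

namespace Summit.QuantumFields.YangMills.Theorems.StaticSourceWitness.Rung

section Lattice

open Literature.Probability.LatticeModels Literature.MathematicalPhysics.QuantumLattice
  Literature.MathematicalPhysics.QuantumFieldTheory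

/-- The lattice Maxwell field of `ℤ⁴` is a probability measure (used as a local instance inside
proofs). [folklore] -/
theorem isProbabilityMeasure_μM : IsProbabilityMeasure μM :=
  isProbabilityMeasure_curvatureGaussianField (by norm_num : 3 ≤ 4) 1

/-- The coordinate process `(q, a) ↦ ω q a` is Gaussian under `μM`. [folklore] -/
theorem isGaussianProcess_eval : IsGaussianProcess
    (fun (s : ZdPlaquette 4 × Fin 1) (ω : Cfg) => ω s.1 s.2) μM :=
  isGaussianProcess_eval_curvatureGaussianField (by norm_num : 3 ≤ 4) 1

/-- Each plaquette curvature `Y_p` is square integrable. [folklore] -/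
theorem memLp_eval (p : ZdPlaquette 4) : MemLp (fun ω : Cfg => ω p 0) 2 μM :=
  (isGaussianProcess_eval.hasGaussianLaw_eval (p, 0)).memLp_two

/-- The finite-sum process `A ↦ ∑_{p ∈ A} Y_p` is Gaussian. [folklore] -/
theorem isGaussianProcess_holonomy :
    IsGaussianProcess (fun (A : Finset (ZdPlaquette 4)) (ω : Cfg) => holonomy A ω) μM := by
  classical
  refine isGaussianProcess_eval.of_isGaussianProcess fun A => ?_
  refine ⟨A.image (fun p => (p, (0 : Fin 1))),
    ∑ t : ↥(A.image fun p => (p, (0 : Fin 1))), ContinuousLinearMap.proj t, fun ω => ?_⟩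
  simp only [FunLike.coe_sum, Finset.sum_apply, ContinuousLinearMap.proj_apply,
    Finset.restrict_def]
  rw [Finset.sum_coe_sort (A.image fun p => (p, (0 : Fin 1))) (fun s => ω s.1 s.2),
    Finset.sum_image (fun p _ p' _ h => (Prod.mk.inj h).1)]
  rfl

/-- `(Φ_rect, Y_q)` is a (centred) Gaussian pair under the lattice Maxwell field. [folklore] -/
theorem hasGaussianLaw_holonomy_plaquette (rect : Finset (ZdPlaquette 4)) (q : ZdPlaquette 4) :
    HasGaussianLaw (fun ω : Cfg => (holonomy rect ω, ω q 0)) μM := by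
  have h := isGaussianProcess_holonomy.hasGaussianLaw_prodMk (s := rect) (t := {q})
  simpa [holonomy] using h

/-- Plaquette curvatures are centred: `E_μ[Y_p] = 0`. [folklore] -/
theorem integral_eval (p : ZdPlaquette 4) : ∫ ω, ω p 0 ∂μM = 0 :=
  integral_eval_curvatureGaussianField (by norm_num : 3 ≤ 4) 1 p 0

/-- The holonomy angle is centred: `E_μ[Φ_rect] = 0`. [folklore] -/
theorem integral_holonomy (rect : Finset (ZdPlaquette 4)) : ∫ ω, holonomy rect ω ∂μM = 0 := by
  haveI := isProbabilityMeasure_μM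
  simp only [holonomy]
  rw [integral_finsetSum rect fun p _ => (memLp_eval p).integrable (by norm_num)]
  exact Finset.sum_eq_zero fun p _ => integral_eval p

/-- **Lattice linear response**: `Cov(Φ_rect, Y_q) = dipoleField rect q`. -/
theorem cov_holonomy_plaquette (rect : Finset (ZdPlaquette 4)) (q : ZdPlaquette 4) :
    cov[holonomy rect, fun ω => ω q 0; μM] = dipoleField rect q := by
  haveI := isProbabilityMeasure_μM
  show cov[fun ω => ∑ p ∈ rect, ω p 0, fun ω => ω q 0; μM] = _
  rw [covariance_fun_sum_left' (fun p _ => memLp_eval p) (memLp_eval q), dipoleField]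
  refine Finset.sum_congr rfl fun p _ => ?_
  rw [covariance_eval_curvatureGaussianField (by norm_num : 3 ≤ 4) 1 p q 0 0, if_pos rfl]

/-- **(★) on the lattice**: `Cov_μ(w, Y_q²) = −E_μ[w] · dipoleField(q)²` for the abelian Wilson loop
`w = cos Φ_rect` of ANY finite plaquette set and ANY plaquette `q`. -/
theorem latticeMaxwell_plaquette_response (rect : Finset (ZdPlaquette 4)) (q : ZdPlaquette 4) :
    (∫ ω, wLoop rect ω * ω q 0 ^ 2 ∂μM) - (∫ ω, wLoop rect ω ∂μM) * (∫ ω, ω q 0 ^ 2 ∂μM)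
      = -((∫ ω, wLoop rect ω ∂μM) * dipoleField rect q ^ 2) := by
  have h := (gaussianPair_staticSource_identity (hasGaussianLaw_holonomy_plaquette rect q)
    (integral_holonomy rect) (integral_eval q)).1
  rw [cov_holonomy_plaquette] at h
  exact h

/-- `E_μ[w] = e^{−Var Φ_rect/2}` (perimeter-small but positive). -/
theorem latticeMaxwell_wLoop_eq (rect : Finset (ZdPlaquette 4)) :
    ∫ ω, wLoop rect ω ∂μM = Real.exp (-(Var[holonomy rect; μM] / 2)) :=
  (gaussianPair_staticSource_identity (V := fun ω => ω (plaquette12 (by norm_num : 3 ≤ 4) 0) 0)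
    (hasGaussianLaw_holonomy_plaquette rect _) (integral_holonomy rect) (integral_eval _)).2

/-- `0 < E_μ[w]`. -/
theorem latticeMaxwell_wLoop_pos (rect : Finset (ZdPlaquette 4)) : 0 < ∫ ω, wLoop rect ω ∂μM := by
  rw [latticeMaxwell_wLoop_eq]; exact Real.exp_pos _

/-- `|w| ≤ 1`. [folklore] -/
theorem abs_wLoop_le (rect : Finset (ZdPlaquette 4)) (ω : Cfg) : |wLoop rect ω| ≤ 1 :=
  Real.abs_cos_le_one _

/-- `Y_q²` is integrable. [folklore] -/
theorem integrable_sq_eval (q : ZdPlaquette 4) : Integrable (fun ω : Cfg => ω q 0 ^ 2) μM :=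
  (memLp_eval q).integrable_sq

/-- `w · Y_q²` is integrable. [folklore] -/
theorem integrable_wLoop_mul_sq (rect : Finset (ZdPlaquette 4)) (q : ZdPlaquette 4) :
    Integrable (fun ω : Cfg => wLoop rect ω * ω q 0 ^ 2) μM := by
  refine (integrable_sq_eval q).mono' ?_ (Filter.Eventually.of_forall fun ω => ?_)
  · have hm : AEStronglyMeasurable (fun ω : Cfg => wLoop rect ω) μM := by
      have : Measurable fun ω : Cfg => holonomy rect ω :=
        Finset.measurable_sum _ fun p _ => (measurable_pi_apply 0).comp (measurable_pi_apply p)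
      exact (Real.continuous_cos.measurable.comp this).aestronglyMeasurable
    exact hm.mul (integrable_sq_eval q).aestronglyMeasurable
  · rw [norm_mul, Real.norm_eq_abs, Real.norm_eq_abs, abs_pow, sq_abs]
    exact mul_le_of_le_one_left (sq_nonneg _) (abs_wLoop_le rect ω)

/-- `w` is integrable. [folklore] -/
theorem integrable_wLoop (rect : Finset (ZdPlaquette 4)) : Integrable (fun ω : Cfg => wLoop rect ω) μM := by
  haveI := isProbabilityMeasure_μM
  refine (integrable_const (1 : ℝ)).mono' ?_ (Filter.Eventually.of_forall fun ω => ?_)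
  · have : Measurable fun ω : Cfg => holonomy rect ω :=
      Finset.measurable_sum _ fun p _ => (measurable_pi_apply 0).comp (measurable_pi_apply p)
    exact (Real.continuous_cos.measurable.comp this).aestronglyMeasurable
  · simpa [Real.norm_eq_abs] using abs_wLoop_le rect ω

/-- **The summed response identity**: `Cov_μ(w, Ṽ_v) = −E_μ[w] · dipoleEnergy` — the
`E[w]`-normalised response of the probe to the static source is EXACTLY minus its classical field
energy, for every spacing `a`, probe `v`, rectangle and volume cut-off `L`. -/
theorem latticeMaxwell_probe_response (a : ℝ) (v : EuclideanSpace ℝ (Fin 4) → ℝ)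
    (rect : Finset (ZdPlaquette 4)) (L : ℕ) :
    (∫ ω, wLoop rect ω * probe a v L ω ∂μM) - (∫ ω, wLoop rect ω ∂μM) * (∫ ω, probe a v L ω ∂μM)
      = -((∫ ω, wLoop rect ω ∂μM) * dipoleEnergy a v rect L) := by
  -- linearity of the three expectations over the finite sums, then (★) termwise
  have e1 : ∫ ω, wLoop rect ω * probe a v L ω ∂μM
      = ∑ y ∈ cube L, v (a • siteToE y) * ∑ q ∈ plaqAt y, ∫ ω, wLoop rect ω * ω q 0 ^ 2 ∂μM := by
    have : ∀ ω : Cfg, wLoop rect ω * probe a v L ω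
        = ∑ y ∈ cube L, v (a • siteToE y) * ∑ q ∈ plaqAt y, wLoop rect ω * ω q 0 ^ 2 := by
      intro ω
      simp only [probe, densA, Finset.mul_sum]
      refine Finset.sum_congr rfl fun y _ => Finset.sum_congr rfl fun q _ => ?_
      ring
    simp_rw [this]
    rw [integral_finsetSum _ fun y _ => ?_]
    · refine Finset.sum_congr rfl fun y _ => ?_
      rw [integral_const_mul, integral_finsetSum _ fun q _ => integrable_wLoop_mul_sq rect q]
    · exact (integrable_finsetSum _ fun q _ => integrable_wLoop_mul_sq rect q).const_mul _
  have e2 : ∫ ω, probe a v L ω ∂μM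
      = ∑ y ∈ cube L, v (a • siteToE y) * ∑ q ∈ plaqAt y, ∫ ω, ω q 0 ^ 2 ∂μM := by
    simp only [probe, densA]
    rw [integral_finsetSum _ fun y _ => ?_]
    · refine Finset.sum_congr rfl fun y _ => ?_
      rw [integral_const_mul, integral_finsetSum _ fun q _ => integrable_sq_eval q]
    · exact (integrable_finsetSum _ fun q _ => integrable_sq_eval q).const_mul _
  have key : ∀ y : Site 4,
      (∑ q ∈ plaqAt y, ∫ ω, wLoop rect ω * ω q 0 ^ 2 ∂μM)
        - (∫ ω, wLoop rect ω ∂μM) * ∑ q ∈ plaqAt y, ∫ ω, ω q 0 ^ 2 ∂μM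
        = -((∫ ω, wLoop rect ω ∂μM) * ∑ q ∈ plaqAt y, dipoleField rect q ^ 2) := by
    intro y
    rw [Finset.mul_sum, Finset.mul_sum, ← Finset.sum_sub_distrib, ← Finset.sum_neg_distrib]
    exact Finset.sum_congr rfl fun q _ => latticeMaxwell_plaquette_response rect q
  rw [e1, e2, dipoleEnergy, Finset.mul_sum, Finset.mul_sum, ← Finset.sum_sub_distrib,
    ← Finset.sum_neg_distrib]
  refine Finset.sum_congr rfl fun y _ => ?_
  rw [mul_left_comm (∫ ω, wLoop rect ω ∂μM) (v (a • siteToE y)), ← mul_sub, key y]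
  ring

/-- **X₁'s instance in lattice Maxwell theory, RATIO form, reduced to the deterministic floor**:
for every rectangle/probe with `c₁ ≤ dipoleEnergy`, the static-source witness clause of
`StaticSourceResponse` holds verbatim — `0 < E[w]` and `c₁ · E[w] ≤ |Cov(w, Ṽ_v)|` — with the same
`c₁` (no loss from the perimeter-small `E[w]`). -/
theorem latticeMaxwell_X1_of_floor {a c₁ : ℝ} {v : EuclideanSpace ℝ (Fin 4) → ℝ}
    {rect : Finset (ZdPlaquette 4)} {L : ℕ} (hfloor : c₁ ≤ dipoleEnergy a v rect L) :
    0 < ∫ ω, wLoop rect ω ∂μM ∧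
    c₁ * ∫ ω, wLoop rect ω ∂μM ≤
      |(∫ ω, wLoop rect ω * probe a v L ω ∂μM)
        - (∫ ω, wLoop rect ω ∂μM) * (∫ ω, probe a v L ω ∂μM)| := by
  have hpos := latticeMaxwell_wLoop_pos rect
  refine ⟨hpos, ?_⟩
  rw [latticeMaxwell_probe_response, abs_neg, abs_mul, abs_of_pos hpos]
  calc c₁ * ∫ ω, wLoop rect ω ∂μM
      ≤ |dipoleEnergy a v rect L| * ∫ ω, wLoop rect ω ∂μM :=
        mul_le_mul_of_nonneg_right (hfloor.trans (le_abs_self _)) hpos.le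
    _ = (∫ ω, wLoop rect ω ∂μM) * |dipoleEnergy a v rect L| := mul_comm _ _

end Lattice

end Summit.QuantumFields.YangMills.Theorems.StaticSourceWitness.Rung

end
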